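import Summits.BirchSwinnertonDyer.BirchSwinnertonDyer.Theorems.ResidualThetaTransportAtTwoPollackPairKUnique
import Summits.BirchSwinnertonDyer.BirchSwinnertonDyer.Theorems.ResidualThetaTransportAtTwoDefs
import HarnessLib

/-!
# stub-ideation k2 · gen 20 — the VALUES RELAY STATION of the `(i)`-half, typed, and its Coleman half PROVED:
# «Mazur–Tate-currency reciprocity for the trivialised column» (MTV_ρ) ⟹ H11 (`hERL` of k3-g19 `price_of_parts`)

Route `ResidualThetaTransportAtTwo` (RTT), crux (R≥)ᵖ `ResidualThetaCountLowerPureAtTwo` (stmt-BirchSwinnertonDyer-26074), line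
«bt26-lambda» v7, stub `stub_cmLambdaLower` = item RSL_g (stmt-BirchSwinnertonDyer-22608) VERBATIM (never re-typed here). Seat
`planner-sidea-stub_cmLambdaLower-2-g20` (technique: literature transfer — recent-theorem / open-question harvest with a TYPED dictionary).
HONEST FRAMING: THEOREMS ONLY (no `def`, no named fact, no instance, no `sorry`); BSD is NOT proved by any of this; RSL_g and (R≥)ᵖ stay OPEN;
nothing here closes, claims or re-types an item. What is proved is commutative algebra in `Λ_𝒪 = 𝒪⟦T⟧` plus one unpacking of the route's OWN
pin bundle `OnePairPins` (…Defs, p-landed).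

THE STATION. STUB-PLAN rev 25.1 S109/S114 prices the k2 lane's `(i)`-half adapter input `⟨e, u, he⟩`; after k2-g19/k3-g19 the open atoms are
H11 `∃ u ≠ 0, e (𝒸 z) = D·(L⁻_g·u)` («ERL, PRINT-PORT, L») and Σ_bal. Print does NOT deliver H11: Kato's Thm. 12.5 (1) delivers VALUES of
`exp*` (character sums = `L(g, χ̄, 1)/Ω`), and Kobayashi's (8.25)/(8.26) turn values of the pairing against Honda points into CONGRUENCES of the
pairing-sum polynomials `P_{2m}(z_i)` with the Mazur–Tate elements `θ_{2m}(g)` modulo `ω_{2m}` — exactly the currency in which the tree DEFINES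
`L⁻_g` (`IsPollackPairK`: `θ_{2m}(g)^ι ≡ (−1)^{m+1} ω⁻_{2m} L⁻ (mod ω_{2m})`, up to a bounded power of `2`, `IsCongrModOmegaO`). So the relay is

  print (Kato 12.5 (1) + BK (3.10.1)) ─K-α (TP2 bricks per Θ-coordinate)→ **MTV_ρ**: `μ·θ_{2m}(g)^ι ≡ ν·w·e(P⃗_{2m}(z)) (mod ω_{2m})`
  ─K-β (THIS FILE, PROVED)→ `C ν · w · e(𝒸 z) = C μ · L⁻_g` ─K-γ (THIS FILE, PROVED)→ H11 for the class `ν•z` with `D := C μ`, `u := w⁻¹`.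

* §1 `IsCongrModOmegaO` algebra (generic `p`, `S`): `isCongrModOmegaO_of_dvd_sub` (move the right member by an INTEGRAL multiple of `ω_n`),
  `isCongrModOmegaO_C_mul` (scale both members by a constant of `𝒪`).
* §2 K-β **`C_mul_mul_eq_C_mul_of_congruences`**: from (a) the column congruences `ω_{2m} ∣ Q_m + (−1)^m ω⁻_{2m}·E` in `Λ_𝒪` (the image under
  ANY additive `Λ`-semilinear `e` of the pin `π.hcol` (5)), (b) MTV_ρ `μθ^ι_{2m} ≡ ν w Q_m`, (c) `IsPollackPairK g ι Ω L⁺ L⁻`: `C ν·w·E = C μ·L⁻` —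
  cancel `ω⁻_{2m}` in the domain, clear the power of `p` against `T ω⁺_{2m} ≡ T^{deg} (mod 𝔪)` (`PollackPairK.dvd_sub_of_isCongrModOmegaO`), and
  `⋂_m (T ω⁺_{2m}) = 0` (`PollackPairK.eq_zero_of_forall_dvd_of_map_eq_X_pow`) — the landed rigidity, here APPLIED to the column.
* §3 K-γ + the pins: **`hERL_of_mazurTateValues`** — for `π : OnePairPins (range ι) …`, a class `z ∈ 𝐇¹`, an additive `Λ`-semilinear `e`, and
  MTV_ρ stated for EVERY Honda datum `(gH, dH)` admitted by `π.hcol`: `∃ ν ≠ 0, D ≠ 0, u ≠ 0, C ν · e (π.cvec z) = D·(L⁻·u)` — the `hERL`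
  input of k3-g19 `price_of_parts` for the class `C ν • z` (constants are free: RSL_g is `μ`-blind, T64/S109).
* §4 why the constant `ν` and the unit `w` are the ONLY slack (frame lemma, PROVED): two `A`-equivariant additive frames `Φ` (lattice, k3-g19
  LATTICE) and `c` (de Rham, through `Θ` on `Fil⁰D_dR`) differ by multiplication by the constant `Φ⁻¹(c 1) ∈ 𝒪` (`symm_frame_eq_mul`); the Honda
  family of `π.hcol` is pinned up to `Λ^×` by (4) `dH 0 ∉ 2E(ℚ_v)` and `π.hcol_surj`.

References: [Kato2004Asterisque] Thm. 12.5 (1)(2) (pp. 221–222), Rem. 12.8, §15.16 (15.16.1), §16.6; [Kobayashi2003] Thm. 6.2, (8.23), Prop. 8.25,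
Lem. 8.26 (pp. 18–23); [Pollack2003] Thm. 5.1, Thm. 5.6, Prop. 6.18, §6.5; [BlochKato1990] (3.10.1); [BurungaleTian2026] Thm. 2.6, Rem. 2.7 (p. 5).
-/

set_option autoImplicit false
-- D-0017: single-problem summit, so `Summit.BirchSwinnertonDyer.BirchSwinnertonDyer.…` repeats a namespace BY DESIGN.
set_option linter.dupNamespace false

noncomputable section

open scoped Classical Polynomial

namespace Summit.BirchSwinnertonDyer.BirchSwinnertonDyer.Cruxes.ResidualThetaCountLowerPureAtTwo.SideaK2G20

open Polynomial (X C)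
open Literature.NumberTheory.EllipticCurves Literature.NumberTheory.EllipticCurves.ModularForms CongruenceSubgroup
  Literature.NumberTheory.Automorphic
  Summit.BirchSwinnertonDyer.BirchSwinnertonDyer.Theorems.PollackPairK

/-! ## §1 Two moves on `θ ≡ L (mod ω_n)` in `Λ_𝒪 ⊗ ℚ` -/

section CongrAlgebra

variable {p : ℕ} [hp : Fact p.Prime] {S : Set (PadicAlgCl p)}

/-- `𝒪⟦T⟧ → ℚ̄_p⟦T⟧` on a constant. [folklore] -/
theorem iwasawaOToPowerSeries_C (c : padicCoeffIntegers S) :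
    iwasawaOToPowerSeries S (PowerSeries.C c) = PowerSeries.C (c : PadicAlgCl p) := by
  rw [iwasawaOToPowerSeries, PowerSeries.map_C]
  rfl

/-- **Moving the right member by an integral multiple of `ω_n`.** If `θ ≡ L₁ (mod ω_n)` in `Λ_𝒪 ⊗ ℚ` and `ω_n ∣ L₁ − L₂` in `Λ_𝒪`,
then `θ ≡ L₂ (mod ω_n)` (same power of `p`). [cite: Pollack2003, Prop. 6.18 (shape of the congruences)] -/
theorem isCongrModOmegaO_of_dvd_sub {n : ℕ} {θ : (PadicAlgCl p)[X]} {L₁ L₂ : IwasawaAlgebraO S}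
    (h : IsCongrModOmegaO S n θ (iwasawaOToPowerSeries S L₁))
    (hd : (((cyclotomicOmega p n).map (Int.castRingHom (padicCoeffIntegers S)) : (padicCoeffIntegers S)[X]) :
        IwasawaAlgebraO S) ∣ L₁ - L₂) :
    IsCongrModOmegaO S n θ (iwasawaOToPowerSeries S L₂) := by
  obtain ⟨m, q, e⟩ := h
  obtain ⟨r, hr⟩ := hd
  refine ⟨m, q + PowerSeries.C (((p : ℕ) : padicCoeffIntegers S) ^ m) * r, ?_⟩
  have hr' := congr_arg (iwasawaOToPowerSeries S) hr
  rw [map_sub, map_mul, iwasawaOToPowerSeries_coe_map] at hr'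
  rw [map_add, map_mul, iwasawaOToPowerSeries_C_natCast_pow]
  linear_combination e + PowerSeries.C ((p : PadicAlgCl p) ^ m) * hr'

/-- **Scaling both members by a constant `c ∈ 𝒪`.** If `θ ≡ P·L (mod ω_n)` in `Λ_𝒪 ⊗ ℚ` then `c·θ ≡ P·(c·L) (mod ω_n)`.
[cite: Pollack2003, Prop. 6.18 (shape of the congruences)] -/
theorem isCongrModOmegaO_C_mul {n : ℕ} {θ : (PadicAlgCl p)[X]} {P : PowerSeries (PadicAlgCl p)} {L : IwasawaAlgebraO S}
    (h : IsCongrModOmegaO S n θ (P * iwasawaOToPowerSeries S L)) (c : padicCoeffIntegers S) :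
    IsCongrModOmegaO S n (Polynomial.C (c : PadicAlgCl p) * θ)
      (P * iwasawaOToPowerSeries S (PowerSeries.C c * L)) := by
  obtain ⟨m, q, e⟩ := h
  refine ⟨m, PowerSeries.C c * q, ?_⟩
  rw [map_mul, map_mul, iwasawaOToPowerSeries_C, Polynomial.coe_mul, Polynomial.coe_C]
  linear_combination (PowerSeries.C (c : PadicAlgCl p)) * e

end CongrAlgebra

/-! ## §2 K-β: the relay — column congruences + MTV_ρ + the Pollack pair ⟹ `C ν · w · E = C μ · L⁻` -/

section Relay

variable {p : ℕ} [hp : Fact p.Prime] {M : ℕ} {g : CuspForm (Gamma0 M) 2} {ι : coeffField g →+* PadicAlgCl p} {Ω : ℂ}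

/-- **K-β (PROVED).** Let `(L⁺, L⁻)` be an `𝒪`-Pollack pair of `g` along `ι`. Let `E ∈ Λ_𝒪` (the trivialised plus-Coleman column
`e(𝒸 z)`) and `Q_m ∈ Λ_𝒪` (the trivialised pairing-sum polynomials `e(P⃗_{2m}(z))`) satisfy the COLUMN CONGRUENCES
`ω_{2m} ∣ Q_m + (−1)^m ω⁻_{2m} E` (the pin `π.hcol` (5) pushed through `e`), and let MTV_ρ hold: `μ·θ_{2m}(g)^ι ≡ ν·w·Q_m (mod ω_{2m})` in
`Λ_𝒪 ⊗ ℚ` for all `m`. Then `C ν · w · E = C μ · L⁻`: both `ν w E` and `μ L⁻` solve `μθ_{2m} ≡ (−1)^{m+1}ω⁻_{2m}·(·) (mod ω_{2m})`, so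
`T ω⁺_{2m}` divides their difference integrally for every `m`, and `⋂_m (T ω⁺_{2m}) = 0`.
[cite: Pollack2003, Thm. 5.1 and Prop. 6.18] [cite: Kobayashi2003, Thm. 6.2 and Prop. 8.25 (pp. 18–23)] [cite: Kato2004Asterisque, Thm. 12.5 (1) (p. 221)] -/
theorem C_mul_mul_eq_C_mul_of_congruences [FiniteDimensional ℚ_[p] (padicCoeffField (Set.range ι))]
    {Lp Lm : IwasawaAlgebraO (Set.range ι)} (hL : IsPollackPairK g ι Ω Lp Lm)
    (E : IwasawaAlgebraO (Set.range ι)) (Q : ℕ → IwasawaAlgebraO (Set.range ι))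
    (μ ν : padicCoeffIntegers (Set.range ι)) (w : IwasawaAlgebraO (Set.range ι))
    (hcol : ∀ m : ℕ, (((cyclotomicOmega p (2 * m)).map (Int.castRingHom (padicCoeffIntegers (Set.range ι))) :
        (padicCoeffIntegers (Set.range ι))[X]) : IwasawaAlgebraO (Set.range ι)) ∣
      Q m + ((((-1) ^ m * cyclotomicOmegaMinus p (2 * m)).map (Int.castRingHom (padicCoeffIntegers (Set.range ι))) :
        (padicCoeffIntegers (Set.range ι))[X]) : IwasawaAlgebraO (Set.range ι)) * E)
    (hMT : ∀ m : ℕ, IsCongrModOmegaO (Set.range ι) (2 * m)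
      (Polynomial.C ((μ : padicCoeffIntegers (Set.range ι)) : PadicAlgCl p) * (mazurTateElementK g Ω p (2 * m)).map ι)
      (iwasawaOToPowerSeries (Set.range ι) (PowerSeries.C ν * w * Q m))) :
    PowerSeries.C ν * w * E = PowerSeries.C μ * Lm := by
  haveI : IsDiscreteValuationRing (padicCoeffIntegers (Set.range ι)) := isDiscreteValuationRing_padicCoeffIntegers
  haveI : CharP (IsLocalRing.ResidueField (padicCoeffIntegers (Set.range ι))) p := charP_residueField_padicCoeffIntegers
  have hsign : ∀ n : ℕ, ((-1 : ℤ[X]) ^ (n / 2 + 1)) = 1 ∨ ((-1 : ℤ[X]) ^ (n / 2 + 1)) = -1 :=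
    fun n ↦ neg_one_pow_eq_or ℤ[X] (n / 2 + 1)
  obtain ⟨-, -, -, heven⟩ := hL
  -- (c) scaled by `μ`: `μ θ_{2m} ≡ ((-1)^{m+1} ω⁻_{2m}) · (μ L⁻)`
  have h₁ : ∀ m : ℕ, IsCongrModOmegaO (Set.range ι) (2 * m)
      (Polynomial.C ((μ : padicCoeffIntegers (Set.range ι)) : PadicAlgCl p) * (mazurTateElementK g Ω p (2 * m)).map ι)
      (((((-1) ^ (2 * m / 2 + 1) * cyclotomicOmegaMinus p (2 * m)).map (Int.castRingHom (PadicAlgCl p)) :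
          (PadicAlgCl p)[X]) : PowerSeries (PadicAlgCl p)) *
        iwasawaOToPowerSeries (Set.range ι) (PowerSeries.C μ * Lm)) :=
    fun m ↦ isCongrModOmegaO_C_mul (heven (2 * m) ⟨m, two_mul m⟩) μ
  -- (a)+(b): `μ θ_{2m} ≡ ν w Q_m ≡ ((-1)^{m+1} ω⁻_{2m}) · (ν w E)` — the second step is an INTEGRAL congruence
  have h₂ : ∀ m : ℕ, IsCongrModOmegaO (Set.range ι) (2 * m)
      (Polynomial.C ((μ : padicCoeffIntegers (Set.range ι)) : PadicAlgCl p) * (mazurTateElementK g Ω p (2 * m)).map ι)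
      (((((-1) ^ (2 * m / 2 + 1) * cyclotomicOmegaMinus p (2 * m)).map (Int.castRingHom (PadicAlgCl p)) :
          (PadicAlgCl p)[X]) : PowerSeries (PadicAlgCl p)) *
        iwasawaOToPowerSeries (Set.range ι) (PowerSeries.C ν * w * E)) := by
    intro m
    have hc : ((-1 : ℤ[X]) ^ (2 * m / 2 + 1) * cyclotomicOmegaMinus p (2 * m)) =
        -((-1) ^ m * cyclotomicOmegaMinus p (2 * m)) := by
      rw [Nat.mul_div_cancel_left m two_pos, pow_succ]; ring
    have key := isCongrModOmegaO_of_dvd_sub (hMT m)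
      (L₂ := ((((-1) ^ (2 * m / 2 + 1) * cyclotomicOmegaMinus p (2 * m)).map
          (Int.castRingHom (padicCoeffIntegers (Set.range ι))) : (padicCoeffIntegers (Set.range ι))[X]) :
            IwasawaAlgebraO (Set.range ι)) * (PowerSeries.C ν * w * E))
      (by
        obtain ⟨r, hr⟩ := hcol m
        refine ⟨PowerSeries.C ν * w * r, ?_⟩
        rw [hc, Polynomial.map_neg, Polynomial.coe_neg]
        linear_combination (PowerSeries.C ν * w) * hr)
    rwa [map_mul, iwasawaOToPowerSeries_coe_map] at key
  -- rigidity: `T ω⁺_{2m} ∣ ν w E − μ L⁻` for all `m`, and `⋂ (T ω⁺_{2m}) = 0`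
  rw [← sub_eq_zero]
  refine eq_zero_of_forall_dvd_of_map_eq_X_pow (O := padicCoeffIntegers (Set.range ι))
    (fun m : ℕ ↦ (((X * cyclotomicOmegaPlus p (2 * m)).map (Int.castRingHom (padicCoeffIntegers (Set.range ι))) :
      (padicCoeffIntegers (Set.range ι))[X]) : IwasawaAlgebraO (Set.range ι)))
    (fun m ↦ (X * cyclotomicOmegaPlus p (2 * m)).natDegree)
    (fun m ↦ map_residue_coe_eq_X_pow p (Polynomial.monic_X.mul (monic_cyclotomicOmegaPlus p _))
      (X_mul_cyclotomicOmegaPlus_dvd p _))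
    (fun k ↦ ⟨k, ?_⟩) (fun m ↦ ?_)
  · rw [Polynomial.monic_X.natDegree_mul (monic_cyclotomicOmegaPlus p _), Polynomial.natDegree_X]
    have := le_natDegree_cyclotomicOmegaPlus p k
    omega
  · exact dvd_sub_of_isCongrModOmegaO (Set.range ι) (hsign (2 * m)) (Polynomial.monic_X.mul (monic_cyclotomicOmegaPlus p _))
      (monic_cyclotomicOmegaMinus p _) (X_mul_cyclotomicOmegaPlus_mul_cyclotomicOmegaMinus p (2 * m)).symm
      (h₁ m) (h₂ m)

/-- **K-γ (PROVED).** If moreover `w` is a unit, the column is `L⁻_g` up to constants: `C ν · E = C μ · (L⁻ · w⁻¹)` — the H11 shape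
`e (𝒸 z') = D·(L⁻·u)` with `D := C μ`, `u := w⁻¹`, for the class `z' = ν•z`. [cite: Kato2004Asterisque, Thm. 12.5 (1) (p. 221)] -/
theorem C_mul_eq_C_mul_mul_inv_of_congruences [FiniteDimensional ℚ_[p] (padicCoeffField (Set.range ι))]
    {Lp Lm : IwasawaAlgebraO (Set.range ι)} (hL : IsPollackPairK g ι Ω Lp Lm)
    (E : IwasawaAlgebraO (Set.range ι)) (Q : ℕ → IwasawaAlgebraO (Set.range ι))
    (μ ν : padicCoeffIntegers (Set.range ι)) (w : (IwasawaAlgebraO (Set.range ι))ˣ)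
    (hcol : ∀ m : ℕ, (((cyclotomicOmega p (2 * m)).map (Int.castRingHom (padicCoeffIntegers (Set.range ι))) :
        (padicCoeffIntegers (Set.range ι))[X]) : IwasawaAlgebraO (Set.range ι)) ∣
      Q m + ((((-1) ^ m * cyclotomicOmegaMinus p (2 * m)).map (Int.castRingHom (padicCoeffIntegers (Set.range ι))) :
        (padicCoeffIntegers (Set.range ι))[X]) : IwasawaAlgebraO (Set.range ι)) * E)
    (hMT : ∀ m : ℕ, IsCongrModOmegaO (Set.range ι) (2 * m)
      (Polynomial.C ((μ : padicCoeffIntegers (Set.range ι)) : PadicAlgCl p) * (mazurTateElementK g Ω p (2 * m)).map ι)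
      (iwasawaOToPowerSeries (Set.range ι) (PowerSeries.C ν * (w : IwasawaAlgebraO (Set.range ι)) * Q m))) :
    PowerSeries.C ν * E = PowerSeries.C μ * (Lm * ((w⁻¹ : (IwasawaAlgebraO (Set.range ι))ˣ) : IwasawaAlgebraO (Set.range ι))) := by
  have H := C_mul_mul_eq_C_mul_of_congruences hL E Q μ ν (w : IwasawaAlgebraO (Set.range ι)) hcol hMT
  have h1 : PowerSeries.C ν * E = PowerSeries.C ν * (w : IwasawaAlgebraO (Set.range ι)) * E *
      ((w⁻¹ : (IwasawaAlgebraO (Set.range ι))ˣ) : IwasawaAlgebraO (Set.range ι)) := by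
    rw [mul_right_comm (PowerSeries.C ν) (w : IwasawaAlgebraO (Set.range ι)) E, Units.mul_inv_cancel_right]
  rw [h1, H, mul_assoc]

end Relay

/-! ## §3 K-γ over the route's OWN pins: `π.hcol` through `e`, then K-β — the `hERL` input of k3-g19 `price_of_parts` -/

section Pins

open Literature.NumberTheory.EllipticCurves.GreenbergSelmer Literature.NumberTheory.GaloisRepresentations
  NumberField IsDedekindDomain Field Kobayashi2003 Rat.HeightOneSpectrum
  Summit.BirchSwinnertonDyer.BirchSwinnertonDyer.Theorems.OnePair

/-- `Λ = ℤ₂⟦X⟧ → Λ_𝒪` on (the power series of) an integer polynomial. [folklore] -/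
theorem map_padicIntToCoeffIntegers_coe_map {p : ℕ} [Fact p.Prime] (S : Set (PadicAlgCl p)) (P : ℤ[X]) :
    PowerSeries.map (padicIntToCoeffIntegers S) ((P.map (Int.castRingHom ℤ_[p]) : ℤ_[p][X]) : PowerSeries ℤ_[p]) =
      ((P.map (Int.castRingHom (padicCoeffIntegers S)) : (padicCoeffIntegers S)[X]) : IwasawaAlgebraO S) := by
  rw [← Polynomial.polynomial_map_coe, Polynomial.map_map,
    RingHom.ext_int ((padicIntToCoeffIntegers S).comp (Int.castRingHom ℤ_[p])) (Int.castRingHom _)]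

variable {M : ℕ} {g : CuspForm (Gamma0 M) 2} {ι : coeffField g →+* PadicAlgCl 2} {Ω : ℂ}
  {W : WeierstrassCurve ℚ} [W.IsElliptic] {κ : ZpExtension ℚ 2} {γ : absoluteGaloisGroup ℚ}
  {S₀ : Finset (HeightOneSpectrum (𝓞 ℚ))} {n : ℕ} {ρ : FramedGaloisRep ℚ ↥(padicCoeffIntegers (Set.range ι)) 2}
  {Θ : ∀ v : HeightOneSpectrum (𝓞 ℚ), ((2 : ℕ) : 𝓞 ℚ) ∈ v.asIdeal →
    (Cofree ρ ↥(padicCoeffField (Set.range ι)) ≃+ (Fin n → ↥(W.geomPrimaryTorsion 2)))}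
  {hΘ : ∀ v hv (δ : absoluteGaloisGroup (v.adicCompletion ℚ)) m i,
    Θ v hv (resGalOfEmb (closureEmb (K := ℚ) (v.adicCompletion ℚ)) δ • m) i =
      resGalOfEmb (closureEmb (K := ℚ) (v.adicCompletion ℚ)) δ • Θ v hv m i}
  {I : Kato2004.IwasawaH1DataCoeff (FramedGaloisRep.toGaloisRep ρ) 2 κ γ}
  {Sg : AddSubgroup (subgroupH1 κ.kerSubgroup (Cofree ρ ↥(padicCoeffField (Set.range ι))))}
  [Module ↥(padicCoeffIntegers (Set.range ι)) ↥Sg]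

set_option maxHeartbeats 1600000 in
/-- **`hERL` from Mazur–Tate VALUES (PROVED modulo the values).** For the pinned one-pair data `π`, a class `z ∈ 𝐇¹_Γ(T_ρ)`, an `𝒪`-Pollack
pair `(L⁺, L⁻)` of `g`, and ANY additive `Λ`-semilinear `e : Λⁿ ≃ Λ_𝒪`: IF for every Honda datum `(gH, dH)` admitted by the pin `π.hcol`
(all six conjuncts, uniqueness included, are handed to the supplier) the Mazur–Tate-currency reciprocity MTV_ρ holds — `μ·θ_{2m}(g)^ι ≡ ν·w·e(P⃗_{2m}(z)) (mod ω_{2m})` in `Λ_𝒪 ⊗ ℚ` for all `m`, with constants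
`μ, ν ∈ 𝒪 ∖ 0` and a unit `w` (`P⃗_{2m}(z)_i` = the pairing-sum polynomial of the coordinate functional `locd₂ z ∘ single i` against the
`gH`-translates of `dH(2m)`, VERBATIM the pin's) — THEN `C ν · e(𝒸 z) = D·(L⁻·u)` with `D = C μ ≠ 0`, `u = w⁻¹ ≠ 0`: the `hERL` input of
k3-g19 `price_of_parts` for the class `ν • z` (constants move `μ`-invariants only; RSL_g is `μ`-blind). MTV_ρ is what Kato's Thm. 12.5 (1)
(values of `exp*`, p. 221, any `p`, CM case §15.16) with (BK) and Kobayashi's Prop. 8.25/Lem. 8.26 per `Θ`-coordinate give; it is NOT proved here.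
[cite: Kato2004Asterisque, Thm. 12.5 (1) (p. 221), §15.16] [cite: Kobayashi2003, Thm. 6.2, (8.23), Prop. 8.25 (pp. 18–23)] [cite: Pollack2003, Thm. 5.1, Prop. 6.18] -/
theorem hERL_of_mazurTateValues [FiniteDimensional ℚ_[2] (padicCoeffField (Set.range ι))]
    (π : OnePairPins (Set.range ι) W κ γ S₀ n ρ Θ hΘ I Sg) (z : I.H)
    {Lp Lm : IwasawaAlgebraO (Set.range ι)} (hL : IsPollackPairK g ι Ω Lp Lm)
    (e : (Fin n → PowerSeries ℤ_[2]) ≃+ IwasawaAlgebraO (Set.range ι))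
    (he : ∀ (r : PowerSeries ℤ_[2]) (t : Fin n → PowerSeries ℤ_[2]),
      e (r • t) = PowerSeries.map (padicIntToCoeffIntegers (Set.range ι)) r * e t)
    (hMT : ∀ (gH : absoluteGaloisGroup (π.v.adicCompletion ℚ)) (dH : ℕ → localPoints W (π.v.adicCompletion ℚ))
      (hdA : ∀ m j, gH ^ j • dH m ∈ Sprung2012.localTowerPointsOfEmb κ (closureEmb (K := ℚ) (π.v.adicCompletion ℚ)) W),
      κ.IsTopGenerator (resGalOfEmb (closureEmb (K := ℚ) (π.v.adicCompletion ℚ)) gH) →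
      (∀ m, dH m ∈ localLayerPointsOfEmb κ (closureEmb (K := ℚ) (π.v.adicCompletion ℚ)) W m) →
      (∀ m, localTraceOfEmb κ (closureEmb (K := ℚ) (π.v.adicCompletion ℚ)) W (m + 1) (m + 2) (dH (m + 2)) = -dH m) →
      (∀ b ∈ localLayerPointsOfEmb κ (closureEmb (K := ℚ) (π.v.adicCompletion ℚ)) W 0, dH 0 ≠ 2 • b) →
      (∀ (z' : ↥(Sprung2012.localTowerPointsOfEmb κ (closureEmb (K := ℚ) (π.v.adicCompletion ℚ)) W) →+ ℤ_[2]) (m : ℕ),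
        (((cyclotomicOmega 2 (2 * m)).map (Int.castRingHom ℤ_[2]) : Polynomial ℤ_[2]) : PowerSeries ℤ_[2]) ∣
          ((∑ j ∈ Finset.range (2 ^ (2 * m)), Polynomial.C (z' ⟨gH ^ j • dH (2 * m), hdA (2 * m) j⟩) * (Polynomial.X + 1) ^ j :
              Polynomial ℤ_[2]) : PowerSeries ℤ_[2]) +
            (-1 : PowerSeries ℤ_[2]) ^ m * (((cyclotomicOmegaMinus 2 (2 * m)).map (Int.castRingHom ℤ_[2]) : Polynomial ℤ_[2]) :
              PowerSeries ℤ_[2]) * π.col z') →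
      (∀ (z' : ↥(Sprung2012.localTowerPointsOfEmb κ (closureEmb (K := ℚ) (π.v.adicCompletion ℚ)) W) →+ ℤ_[2])
        (Lz : PowerSeries ℤ_[2]),
        (∀ m : ℕ, (((cyclotomicOmega 2 (2 * m)).map (Int.castRingHom ℤ_[2]) : Polynomial ℤ_[2]) : PowerSeries ℤ_[2]) ∣
          ((∑ j ∈ Finset.range (2 ^ (2 * m)), Polynomial.C (z' ⟨gH ^ j • dH (2 * m), hdA (2 * m) j⟩) * (Polynomial.X + 1) ^ j :
              Polynomial ℤ_[2]) : PowerSeries ℤ_[2]) +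
            (-1 : PowerSeries ℤ_[2]) ^ m * (((cyclotomicOmegaMinus 2 (2 * m)).map (Int.castRingHom ℤ_[2]) : Polynomial ℤ_[2]) :
              PowerSeries ℤ_[2]) * Lz) → Lz = π.col z') →
      ∃ (μ ν : padicCoeffIntegers (Set.range ι)) (w : IwasawaAlgebraO (Set.range ι)), μ ≠ 0 ∧ ν ≠ 0 ∧ IsUnit w ∧
        ∀ m : ℕ, IsCongrModOmegaO (Set.range ι) (2 * m)
          (Polynomial.C ((μ : padicCoeffIntegers (Set.range ι)) : PadicAlgCl 2) * (mazurTateElementK g Ω 2 (2 * m)).map ι)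
          (iwasawaOToPowerSeries (Set.range ι) (PowerSeries.C ν * w *
            e (fun i => ((∑ j ∈ Finset.range (2 ^ (2 * m)),
                Polynomial.C (((π.locd₂ z).comp (AddMonoidHom.single
                  (fun _ : Fin n => ↥(Sprung2012.localTowerPointsOfEmb κ (closureEmb (K := ℚ) (π.v.adicCompletion ℚ)) W)) i))
                  ⟨gH ^ j • dH (2 * m), hdA (2 * m) j⟩) * (Polynomial.X + 1) ^ j : Polynomial ℤ_[2]) : PowerSeries ℤ_[2])))))
    : ∃ (ν : padicCoeffIntegers (Set.range ι)) (D u : IwasawaAlgebraO (Set.range ι)), ν ≠ 0 ∧ D ≠ 0 ∧ u ≠ 0 ∧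
        PowerSeries.C ν * e (π.cvec z) = D * (Lm * u) := by
  obtain ⟨gH, dH, hdA, hgen, hlay, htr, hndiv, hcong, huniq⟩ := π.hcol
  obtain ⟨μ, ν, w, hμ, hν, ⟨wu, rfl⟩, hMTV⟩ := hMT gH dH hdA hgen hlay htr hndiv hcong huniq
  -- (a) the pin's congruences, coordinate functional by coordinate functional, pushed through `e`
  have hcolO : ∀ m : ℕ, (((cyclotomicOmega 2 (2 * m)).map (Int.castRingHom (padicCoeffIntegers (Set.range ι))) :
        (padicCoeffIntegers (Set.range ι))[X]) : IwasawaAlgebraO (Set.range ι)) ∣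
      e (fun i => ((∑ j ∈ Finset.range (2 ^ (2 * m)),
          Polynomial.C (((π.locd₂ z).comp (AddMonoidHom.single
            (fun _ : Fin n => ↥(Sprung2012.localTowerPointsOfEmb κ (closureEmb (K := ℚ) (π.v.adicCompletion ℚ)) W)) i))
            ⟨gH ^ j • dH (2 * m), hdA (2 * m) j⟩) * (Polynomial.X + 1) ^ j : Polynomial ℤ_[2]) : PowerSeries ℤ_[2])) +
        ((((-1) ^ m * cyclotomicOmegaMinus 2 (2 * m)).map (Int.castRingHom (padicCoeffIntegers (Set.range ι))) :
          (padicCoeffIntegers (Set.range ι))[X]) : IwasawaAlgebraO (Set.range ι)) * e (π.cvec z) := by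
    intro m
    choose b hb using fun i : Fin n => hcong ((π.locd₂ z).comp (AddMonoidHom.single
      (fun _ : Fin n => ↥(Sprung2012.localTowerPointsOfEmb κ (closureEmb (K := ℚ) (π.v.adicCompletion ℚ)) W)) i)) m
    refine ⟨e b, ?_⟩
    have hvec : (fun i => ((∑ j ∈ Finset.range (2 ^ (2 * m)),
          Polynomial.C (((π.locd₂ z).comp (AddMonoidHom.single
            (fun _ : Fin n => ↥(Sprung2012.localTowerPointsOfEmb κ (closureEmb (K := ℚ) (π.v.adicCompletion ℚ)) W)) i))
            ⟨gH ^ j • dH (2 * m), hdA (2 * m) j⟩) * (Polynomial.X + 1) ^ j : Polynomial ℤ_[2]) : PowerSeries ℤ_[2])) +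
        ((((-1) ^ m * cyclotomicOmegaMinus 2 (2 * m)).map (Int.castRingHom ℤ_[2]) : ℤ_[2][X]) : PowerSeries ℤ_[2]) • π.cvec z =
        (((cyclotomicOmega 2 (2 * m)).map (Int.castRingHom ℤ_[2]) : ℤ_[2][X]) : PowerSeries ℤ_[2]) • b := by
      funext i
      simp only [Pi.add_apply, Pi.smul_apply, smul_eq_mul, OnePairPins.cvec_apply]
      rw [← hb i]
      simp only [Polynomial.map_mul, Polynomial.map_pow, Polynomial.map_neg, Polynomial.map_one, Polynomial.coe_mul,
        Polynomial.coe_pow, Polynomial.coe_neg, Polynomial.coe_one]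
    have key := congr_arg e hvec
    rw [map_add, he, he, map_padicIntToCoeffIntegers_coe_map, map_padicIntToCoeffIntegers_coe_map] at key
    exact key
  -- (b)+(c): K-β / K-γ
  have H := C_mul_eq_C_mul_mul_inv_of_congruences hL (e (π.cvec z)) (fun m => e (fun i =>
      ((∑ j ∈ Finset.range (2 ^ (2 * m)),
          Polynomial.C (((π.locd₂ z).comp (AddMonoidHom.single
            (fun _ : Fin n => ↥(Sprung2012.localTowerPointsOfEmb κ (closureEmb (K := ℚ) (π.v.adicCompletion ℚ)) W)) i))
            ⟨gH ^ j • dH (2 * m), hdA (2 * m) j⟩) * (Polynomial.X + 1) ^ j : Polynomial ℤ_[2]) : PowerSeries ℤ_[2])))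
    μ ν wu hcolO hMTV
  refine ⟨ν, PowerSeries.C μ, ((wu⁻¹ : (IwasawaAlgebraO (Set.range ι))ˣ) : IwasawaAlgebraO (Set.range ι)), hν, ?_,
    Units.ne_zero _, H⟩
  intro h0
  exact hμ (by simpa using congr_arg (PowerSeries.coeff 0) h0)

end Pins

/-! ## §4 Why `ν` is the only slack between the lattice frame and the de Rham frame (PROVED) -/

section Frame

variable {𝒪 R : Type*} [CommRing 𝒪] [CommRing R] {n : ℕ}

/-- **Two `A`-equivariant additive frames differ by an `𝒪`-linear map.** If `Φ : 𝒪 ≃+ Rⁿ` (the lattice frame of k3-g19 LATTICE) and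
`c : 𝒪 →+ Rⁿ` (the de Rham frame induced by `Θ` on `Fil⁰D_dR`) both intertwine multiplication by `a` with the matrix `A a`, then
`Φ⁻¹ ∘ c` is `𝒪`-linear. [cite: Kato2004Asterisque, §13.8 (p. 228)] -/
theorem symm_frame_mul (A : 𝒪 → Matrix (Fin n) (Fin n) R) (Φ : 𝒪 ≃+ (Fin n → R)) (c : 𝒪 →+ (Fin n → R))
    (hΦ : ∀ a b : 𝒪, Φ (a * b) = (A a).mulVec (Φ b)) (hc : ∀ a b : 𝒪, c (a * b) = (A a).mulVec (c b)) (a b : 𝒪) :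
    Φ.symm (c (a * b)) = a * Φ.symm (c b) := by
  apply Φ.injective
  rw [Φ.apply_symm_apply, hΦ, Φ.apply_symm_apply, hc]

/-- Hence `Φ⁻¹ ∘ c` is multiplication by the CONSTANT `β = Φ⁻¹(c 1) ∈ 𝒪`: the values read in the de Rham frame and the column read in
the lattice frame differ by one constant of `𝒪` — the `ν/μ` of MTV_ρ, never a non-constant power series. [cite: Kato2004Asterisque, §13.8 (p. 228)] -/
theorem symm_frame_eq_mul (A : 𝒪 → Matrix (Fin n) (Fin n) R) (Φ : 𝒪 ≃+ (Fin n → R)) (c : 𝒪 →+ (Fin n → R))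
    (hΦ : ∀ a b : 𝒪, Φ (a * b) = (A a).mulVec (Φ b)) (hc : ∀ a b : 𝒪, c (a * b) = (A a).mulVec (c b)) (a : 𝒪) :
    Φ.symm (c a) = a * Φ.symm (c 1) := by
  rw [← symm_frame_mul A Φ c hΦ hc a 1, mul_one]

end Frame

end Summit.BirchSwinnertonDyer.BirchSwinnertonDyer.Cruxes.ResidualThetaCountLowerPureAtTwo.SideaK2G20

end
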